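import Literature.MathematicalPhysics.KineticTheory.RiemannLocalGibbsHardCore
import HarnessLib

/-!
# The hard-sphere specification on inner windows: product decomposition and decay of the
# boundary influence

Topic `Literature/MathematicalPhysics/KineticTheory`; PROOFS (no definitions, no named facts),
second file towards the discharge of
`Literature.MathematicalPhysics.KineticTheory.RiemannLocalGibbsExistsUnique`
(`RiemannLocalGibbsLaw.lean`), continuing `RiemannLocalGibbsHardCore.lean`.

For a one-particle intensity `ν` on `Phase = ℝ³ × ℝ³` (locally finite, atomless) write
`P_X = poissonLaw (ν|_{X × ℝ³})` for the reference Poisson law of the region `X ⊆ ℝ³` and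
`Z_X(F) = P_X{hard core, no point in F}`.

* **Windows** (`ae_restrict_window_eq_self`, `poissonLaw_restrict_union`): `P_X` is carried by
  configurations inside the window of `X`; for disjoint regions the Poisson law of the union is the
  law of the union of independent samples (the tree's Superposition Theorem + Rényi uniqueness).
* **The specification seen in an inner window** (`lintegral_glue_preimage_eq`,
  `hsLocalSpec_apply_preimage_restrict`): for `Δ ⊆ Λ` and a boundary condition `η`,
  `γ_Λ(η)(ξ|_Δ ∈ A') = ∫_{A'} 1[ξ ∪ η_out hard core] Z_{Λ∖Δ}(F(η_out) ∪ F(ξ)) P_Δ(dξ) / (same with A' = univ)`,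
  `F(c) = ⋃_{x ∈ c} B°_σ(x)` the region forbidden by `c` — integrate out the configuration in
  `Λ ∖ Δ` (Fubini over the superposition).
* **Product bound** (`abs_ratio_biUnion_sub_le`): by telescoping over the points of a finite `ξ`
  and the decay lemma `abs_ratio_sub_ratio_le_pow`, the ratios `Z_V(F ∪ F(ξ))/Z_V(F)` of two
  systems agreeing on the window of `G` differ by at most `#ξ · (2κ)^d` when every point of `ξ`
  is at depth `d` inside `G`.
* **Decay of the boundary influence on local events** (`abs_hsLocalSpec_sub_le`; the uniqueness
  mechanism of Michelen–Perkins 2021, Thm 25 / §5, in DLR form): for `Λ = B(0, R)`, the inner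
  window `Δ = B(0, k)` and two boundary conditions `η, η'` hard core outside `Λ`,
  `|γ_Λ(η)(A) - γ_Λ(η')(A)| ≤ 2 ν(Δ × ℝ³) e^{ν(Δ × ℝ³)} (2κ)^d` for every event `A` measurable
  with respect to the configuration in `Δ`, whenever `k + (d + 2)σ ≤ R` and `ν` gives mass `≤ κ`
  to every ball window.

## References

* M. Michelen, W. Perkins, *Potential-weighted connective constants and uniqueness of Gibbs
  measures*, arXiv:2109.01094, §3 (densities of finite-volume Gibbs measures w.r.t. the Poisson
  process, Lemma 14), §5 (uniqueness from convergence of finite-volume quantities uniformly in the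
  boundary condition). [MichelenPerkins2021]
* H.-O. Georgii, *Gibbs Measures and Phase Transitions* (2011), Def. 1.23 (specifications).
* J. F. C. Kingman, *Poisson Processes* (1993), §2.2 (Superposition Theorem).
-/

noncomputable section

open MeasureTheory ProbabilityTheory Set Filter
open scoped ENNReal NNReal

namespace Literature.MathematicalPhysics.KineticTheory

open Literature.Analysis.FunctionSpaces
open Literature.MathematicalPhysics.StatisticalMechanics
open Literature.MathematicalPhysics.StatisticalMechanics.HardSphere (Pos Phase window hardCoreSet
  glue poissonLaw IsHardCore)

/-! ### Poisson laws on windows: support and superposition -/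

section Windows

variable (ν : Measure Phase) [IsLocallyFiniteMeasure ν]

/-- `poissonLaw (ν|_s)` is a Poisson point process with intensity `ν|_s` for a locally finite
atomless `ν` (no junk branch). [cite: Kingman1993, §2.5 Existence Theorem] -/
theorem isPoissonPointProcess_poissonLaw_restrict' (h0 : ∀ x, ν {x} = 0) (s : Set Phase) :
    IsPoissonPointProcess (ν.restrict s) (poissonLaw (ν.restrict s)) :=
  HardSphere.isPoissonPointProcess_poissonLaw _ fun x =>
    nonpos_iff_eq_zero.mp ((Measure.restrict_apply_le _ _).trans_eq (h0 x))

/-- **A Poisson law with intensity carried by `s` has a.s. no point outside `s`** (the count of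
`sᶜ` is Poisson with mean `0`). [cite: Kingman1993, §2.1] -/
theorem ae_count_compl_eq_zero (h0 : ∀ x, ν {x} = 0) {s : Set Phase} (hs : MeasurableSet s) :
    ∀ᵐ ζ ∂(poissonLaw (ν.restrict s)), ζ.count sᶜ = 0 := by
  have hP := isPoissonPointProcess_poissonLaw_restrict' ν h0 s
  haveI := hP.isProbabilityMeasure
  have hνc : ν.restrict s sᶜ = 0 := by
    rw [Measure.restrict_apply hs.compl, compl_inter_self, measure_empty]
  have h1 : poissonLaw (ν.restrict s) {ζ | ζ.count sᶜ = 0} = 1 := by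
    rw [hP.measure_count_eq_zero hs.compl (by rw [hνc]; exact ENNReal.zero_ne_top), hνc]
    simp
  rw [ae_iff, show {ζ : PointConfig Phase | ¬ζ.count sᶜ = 0} = {ζ | ζ.count sᶜ = 0}ᶜ from rfl,
    prob_compl_eq_zero_iff (measurableSet_count_eq_zero hs.compl)]
  exact h1

/-- Hence a.s. the configuration coincides with its restriction to `s`. [cite: Kingman1993, §2.1] -/
theorem ae_restrict_eq_self (h0 : ∀ x, ν {x} = 0) {s : Set Phase} (hs : MeasurableSet s) :
    ∀ᵐ ζ ∂(poissonLaw (ν.restrict s)), ζ.restrict s = ζ := by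
  filter_upwards [ae_count_compl_eq_zero ν h0 hs] with ζ hζ
  refine PointConfig.ext fun x => ⟨fun hx => hx.1, fun hx => ⟨hx, ?_⟩⟩
  by_contra hxs
  exact (count_eq_zero_iff'.1 hζ) x hx hxs

/-- **Superposition**: for disjoint `s, t` the Poisson law with intensity `ν|_{s ∪ t}` is the law
of the union of independent samples of the Poisson laws with intensities `ν|_s`, `ν|_t` (Kingman's
Superposition Theorem and the uniqueness of the Poisson law, both proved in the tree).
[cite: Kingman1993, §2.2 Superposition Theorem] -/
theorem poissonLaw_restrict_union (h0 : ∀ x, ν {x} = 0) {s t : Set Phase} (ht : MeasurableSet t)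
    (hst : Disjoint s t) :
    poissonLaw (ν.restrict (s ∪ t)) =
      ((poissonLaw (ν.restrict s)).prod (poissonLaw (ν.restrict t))).map
        (fun p : PointConfig Phase × PointConfig Phase => p.1 ∪ p.2) := by
  have hPs := isPoissonPointProcess_poissonLaw_restrict' ν h0 s
  have hPt := isPoissonPointProcess_poissonLaw_restrict' ν h0 t
  have hPst := isPoissonPointProcess_poissonLaw_restrict' ν h0 (s ∪ t)
  have hsup := IsPoissonPointProcess.superposition_holds hPs hPt
  rw [← Measure.restrict_union hst ht] at hsup
  exact IsPoissonPointProcess.unique_holds hPst hsup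

/-- The window of a difference of regions: `(Λ ∖ Δ) × ℝ³ = Λ × ℝ³ ∖ Δ × ℝ³`. [folklore] -/
theorem window_diff (Λ Δ : Set Pos) : window (Λ \ Δ) = window Λ \ window Δ := by
  ext x; simp [HardSphere.mem_window]

/-- The window of a union of regions. [folklore] -/
theorem window_union (Λ Δ : Set Pos) : window (Λ ∪ Δ) = window Λ ∪ window Δ := by
  ext x; simp [HardSphere.mem_window]

/-- The window of the complement. [folklore] -/
theorem window_compl (Λ : Set Pos) : window Λᶜ = (window Λ)ᶜ := by
  ext x; simp [HardSphere.mem_window]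

/-- Windows are monotone. [folklore] -/
theorem window_mono {Λ Δ : Set Pos} (h : Δ ⊆ Λ) : window Δ ⊆ window Λ := fun x hx => by
  rw [HardSphere.mem_window] at hx ⊢; exact h hx

/-- Windows of disjoint regions are disjoint. [folklore] -/
theorem disjoint_window {Λ Δ : Set Pos} (h : Disjoint Λ Δ) : Disjoint (window Λ) (window Δ) := by
  rw [Set.disjoint_left] at h ⊢
  intro x hx hx'
  rw [HardSphere.mem_window] at hx hx'
  exact h hx hx'

/-- **The reference law of `Λ` is the superposition of the reference laws of an inner region
`Δ ⊆ Λ` and of `Λ ∖ Δ`.** [cite: Kingman1993, §2.2 Superposition Theorem] -/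
theorem poissonLaw_window_eq_map_prod (h0 : ∀ x, ν {x} = 0) {Λ Δ : Set Pos}
    (hΛ : MeasurableSet Λ) (hΔ : MeasurableSet Δ) (hΔΛ : Δ ⊆ Λ) :
    poissonLaw (ν.restrict (window Λ)) =
      ((poissonLaw (ν.restrict (window Δ))).prod (poissonLaw (ν.restrict (window (Λ \ Δ))))).map
        (fun p : PointConfig Phase × PointConfig Phase => p.1 ∪ p.2) := by
  have h := poissonLaw_restrict_union ν h0 (s := window Δ) (t := window (Λ \ Δ))
    (HardSphere.measurableSet_window (hΛ.diff hΔ))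
    (disjoint_window disjoint_sdiff_right)
  rwa [← window_union, union_sdiff_cancel hΔΛ] at h

end Windows

/-! ### The region forbidden by a configuration -/

/-- Membership in the region forbidden by `c`: some point of `c` is `σ`-close in position.
[folklore] -/
theorem mem_biUnion_window_ball_iff {σ : ℝ} {c : Set Phase} {y : Phase} :
    y ∈ (⋃ x ∈ c, window (Metric.ball x.1 σ)) ↔ ∃ x ∈ c, dist y.1 x.1 < σ := by
  simp only [mem_iUnion, mem_window_ball, exists_prop]

/-- The region forbidden by a countable set of points is measurable. [folklore] -/
theorem measurableSet_biUnion_window_ball (σ : ℝ) {c : Set Phase} (hc : c.Countable) :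
    MeasurableSet (⋃ x ∈ c, window (Metric.ball x.1 σ)) :=
  MeasurableSet.biUnion hc fun x _ => measurableSet_window_ball σ x

/-- The region forbidden by a configuration is measurable (configurations are countable).
[folklore] -/
theorem measurableSet_biUnion_window_ball_carrier (σ : ℝ) (c : PointConfig Phase) :
    MeasurableSet (⋃ x ∈ (c : Set Phase), window (Metric.ball x.1 σ)) :=
  measurableSet_biUnion_window_ball σ c.countable_carrier

/-- **No point of `ζ` in the region forbidden by `c` iff all cross pairs are `σ`-separated.**
[folklore] -/
theorem count_biUnion_window_ball_eq_zero_iff {σ : ℝ} {c : Set Phase} {ζ : PointConfig Phase} :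
    ζ.count (⋃ x ∈ c, window (Metric.ball x.1 σ)) = 0 ↔ ∀ x ∈ c, ∀ y ∈ ζ, σ ≤ dist x.1 y.1 := by
  rw [count_eq_zero_iff']
  simp only [mem_biUnion_window_ball_iff, not_exists, not_and, not_lt]
  exact ⟨fun h x hx y hy => by rw [dist_comm]; exact h y hy x hx,
    fun h y hy x hx => by rw [dist_comm]; exact h x hx y hy⟩

/-- **Hard core of a superposition of disjoint configurations** through the forbidden region:
if `c` and `ζ` share no point, `c ∪ ζ` is hard core iff `c` and `ζ` are and `ζ` has no point in
the region forbidden by `c`. [folklore] -/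
theorem isHardCore_union_iff_count_eq_zero {σ : ℝ} {c ζ : PointConfig Phase}
    (hdisj : Disjoint (c : Set Phase) (ζ : Set Phase)) :
    IsHardCore σ (c ∪ ζ) ↔ IsHardCore σ c ∧ IsHardCore σ ζ ∧
      ζ.count (⋃ x ∈ (c : Set Phase), window (Metric.ball x.1 σ)) = 0 := by
  rw [isHardCore_union_iff, count_biUnion_window_ball_eq_zero_iff]
  refine and_congr_right fun _ => and_congr_right fun _ => ⟨fun h x hx y hy => h x hx y hy ?_,
    fun h x hx y hy _ => h x hx y hy⟩
  rintro rfl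
  exact Set.disjoint_left.1 hdisj hx hy

/-! ### Telescoping over the points of a finite configuration -/

section Product

variable {σ : ℝ}

/-- **Product bound.** In the setting of the decay lemma `abs_ratio_sub_ratio_le_pow` (two finite
Poisson hard-core systems agreeing on the window of `G`), for a finite set of points `s` each at
depth `d` inside `G` (`ball(x, (d+1)σ) ⊆ G`), the ratios `Z(F ∪ F(s))/Z(F)` with
`F(s) = ⋃_{x ∈ s} B°_σ(x)` differ between the two systems by at most `#s · (2κ)^d` — telescoping
`Z(F ∪ B°(x) ∪ F(s'))/Z(F) = (Z(F ∪ B°(x))/Z(F)) · (Z(F ∪ B°(x) ∪ F(s'))/Z(F ∪ B°(x)))` and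
induction on `s`. [cite: MichelenPerkins2021, §3.3, Lemma 20 and §5.1] -/
theorem abs_ratio_biUnion_sub_le (hσ : 0 < σ) {κ : ℝ}
    {m₁ m₂ : Measure Phase} [IsFiniteMeasure m₁] [IsFiniteMeasure m₂]
    {P₁ P₂ : Measure (PointConfig Phase)}
    (hP₁ : IsPoissonPointProcess m₁ P₁) (hP₂ : IsPoissonPointProcess m₂ P₂)
    (hm₁ : ∀ t : ℝ, m₁ {y : Phase | y.1 0 = t} = 0) (hm₂ : ∀ t : ℝ, m₂ {y : Phase | y.1 0 = t} = 0)
    (hκ : ∀ a : Pos, m₁.real (window (Metric.ball a σ)) ≤ κ)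
    {G : Set Pos} (hG : m₁.restrict (window G) = m₂.restrict (window G)) (d : ℕ)
    (s : Set Phase) (hs : s.Finite) :
    (∀ x ∈ s, Metric.ball x.1 ((d + 1) * σ) ⊆ G) →
    ∀ (F₁ F₂ : Set Phase), MeasurableSet F₁ → MeasurableSet F₂ → F₁ ∩ window G = F₂ ∩ window G →
      |P₁.real (hardCoreSet σ ∩ {ζ : PointConfig Phase |
            ζ.count (F₁ ∪ ⋃ x ∈ s, window (Metric.ball x.1 σ)) = 0}) /
          P₁.real (hardCoreSet σ ∩ {ζ : PointConfig Phase | ζ.count F₁ = 0}) -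
        P₂.real (hardCoreSet σ ∩ {ζ : PointConfig Phase |
            ζ.count (F₂ ∪ ⋃ x ∈ s, window (Metric.ball x.1 σ)) = 0}) /
          P₂.real (hardCoreSet σ ∩ {ζ : PointConfig Phase | ζ.count F₂ = 0})| ≤
        s.ncard * (2 * κ) ^ d := by
  induction s, hs using Set.Finite.induction_on with
  | empty =>
    intro _ F₁ F₂ _ _ _
    simp only [mem_empty_iff_false, iUnion_of_empty, iUnion_empty, union_empty, ncard_empty,
      Nat.cast_zero, zero_mul]
    rw [div_self (measureReal_hardCore_void_pos hP₁ σ F₁).ne',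
      div_self (measureReal_hardCore_void_pos hP₂ σ F₂).ne', sub_self, abs_zero]
  | @insert a s ha hs ih =>
    intro hdepth F₁ F₂ hF₁ hF₂ hF
    have hda : Metric.ball a.1 ((d + 1) * σ) ⊆ G := hdepth a (mem_insert a s)
    have hds : ∀ x ∈ s, Metric.ball x.1 ((d + 1) * σ) ⊆ G := fun x hx =>
      hdepth x (mem_insert_of_mem a hx)
    rw [biUnion_insert, ratio_union_eq_mul hP₁ σ, ratio_union_eq_mul hP₂ σ,
      ncard_insert_of_notMem ha hs, Nat.cast_add, Nat.cast_one, add_mul, one_mul, add_comm]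
    have hA := abs_ratio_sub_ratio_le_pow hσ hP₁ hP₂ hm₁ hm₂ hκ hG d a.1 hda
      (window (Metric.ball a.1 σ)) (measurableSet_window_ball σ a) subset_rfl F₁ F₂ hF₁ hF₂ hF
    have hF' : (F₁ ∪ window (Metric.ball a.1 σ)) ∩ window G =
        (F₂ ∪ window (Metric.ball a.1 σ)) ∩ window G := by
      rw [union_inter_distrib_right, union_inter_distrib_right, hF]
    have hB := ih hds (F₁ ∪ window (Metric.ball a.1 σ)) (F₂ ∪ window (Metric.ball a.1 σ))
      (hF₁.union (measurableSet_window_ball σ a)) (hF₂.union (measurableSet_window_ball σ a)) hF'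
    calc _ ≤ _ := abs_mul_sub_mul_le (ratio_nonneg P₁ σ _ _) (ratio_le_one hP₁ σ _ _)
          (ratio_nonneg P₂ σ _ _) (ratio_le_one hP₂ σ _ _)
      _ ≤ (2 * κ) ^ d + s.ncard * (2 * κ) ^ d := add_le_add hA hB

end Product

/-- **Quotients of close quantities**: if `0 ≤ N' ≤ D'`, `D, D' ≥ p > 0` and
`|N - N'|, |D - D'| ≤ e`, then `|N/D - N'/D'| ≤ 2e/p`. [folklore] -/
theorem abs_div_sub_div_le_of_abs_sub_le {N N' D D' p e : ℝ} (hp : 0 < p)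
    (hN' : 0 ≤ N') (hND' : N' ≤ D') (hD : p ≤ D) (hD' : p ≤ D')
    (hNN : |N - N'| ≤ e) (hDD : |D - D'| ≤ e) : |N / D - N' / D'| ≤ 2 * e / p := by
  have hDpos : 0 < D := lt_of_lt_of_le hp hD
  have hD'pos : 0 < D' := lt_of_lt_of_le hp hD'
  have he : 0 ≤ e := le_trans (abs_nonneg _) hNN
  have h1 : |N / D - N' / D| ≤ e / p := by
    rw [← sub_div, abs_div, abs_of_pos hDpos]
    exact div_le_div₀ he hNN hp hD
  have h2 : |N' / D - N' / D'| ≤ e / p := by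
    have hq : N' / D' ≤ 1 := div_le_one_of_le₀ hND' hD'pos.le
    have : N' / D - N' / D' = (N' / D') * ((D' - D) / D) := by
      field_simp
    rw [this, abs_mul, abs_of_nonneg (div_nonneg hN' hD'pos.le), abs_div, abs_of_pos hDpos,
      abs_sub_comm]
    calc N' / D' * (|D - D'| / D) ≤ 1 * (e / p) := by gcongr
      _ = e / p := one_mul _
  calc |N / D - N' / D'| = |(N / D - N' / D) + (N' / D - N' / D')| := by ring_nf
    _ ≤ |N / D - N' / D| + |N' / D - N' / D'| := abs_add_le _ _
    _ ≤ e / p + e / p := add_le_add h1 h2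
    _ = 2 * e / p := by ring

/-! ### The specification seen in an inner window -/

section InnerWindow

variable (ν : Measure Phase) [IsLocallyFiniteMeasure ν] {σ : ℝ}

/-- **Gluing a superposition**: if `ξ` lives in the window of `Δ ⊆ Λ` and `ζ` in the window of
`Λ ∖ Δ`, then gluing `ξ ∪ ζ` into `Λ` with boundary condition `η` gives `(ξ ∪ η|_{Λᶜ}) ∪ ζ`.
[folklore] -/
theorem glue_union_eq {Λ Δ : Set Pos} (hΔΛ : Δ ⊆ Λ) (η : PointConfig Phase)
    {ξ ζ : PointConfig Phase} (hξ : ξ.restrict (window Δ) = ξ)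
    (hζ : ζ.restrict (window (Λ \ Δ)) = ζ) :
    glue Λ η (ξ ∪ ζ) = (ξ ∪ η.restrict (window Λ)ᶜ) ∪ ζ := by
  have hξ' : ∀ x ∈ ξ, x ∈ window Λ := fun x hx => by
    rw [← hξ] at hx; exact window_mono hΔΛ hx.2
  have hζ' : ∀ x ∈ ζ, x ∈ window Λ := fun x hx => by
    rw [← hζ] at hx; exact window_mono sdiff_subset hx.2
  refine PointConfig.ext fun x => ?_
  simp only [glue, PointConfig.mem_union, mem_restrict_iff, mem_compl_iff]
  constructor
  · rintro (⟨hx | hx, -⟩ | ⟨hx, hxΛ⟩)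
    · exact Or.inl (Or.inl hx)
    · exact Or.inr hx
    · exact Or.inl (Or.inr ⟨hx, hxΛ⟩)
  · rintro ((hx | ⟨hx, hxΛ⟩) | hx)
    · exact Or.inl ⟨Or.inl hx, hξ' x hx⟩
    · exact Or.inr ⟨hx, hxΛ⟩
    · exact Or.inl ⟨Or.inr hx, hζ' x hx⟩

/-- Under the same support conditions the glued configuration restricted to the inner window is
`ξ`. [folklore] -/
theorem restrict_union_union_eq {Λ Δ : Set Pos} (hΔΛ : Δ ⊆ Λ) (η : PointConfig Phase)
    {ξ ζ : PointConfig Phase} (hξ : ξ.restrict (window Δ) = ξ)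
    (hζ : ζ.restrict (window (Λ \ Δ)) = ζ) :
    ((ξ ∪ η.restrict (window Λ)ᶜ) ∪ ζ).restrict (window Δ) = ξ := by
  refine PointConfig.ext fun x => ?_
  simp only [PointConfig.mem_union, mem_restrict_iff, mem_compl_iff]
  constructor
  · rintro ⟨(hx | ⟨-, hxΛ⟩) | hx, hxΔ⟩
    · exact hx
    · exact absurd (window_mono hΔΛ hxΔ) hxΛ
    · rw [← hζ] at hx
      have h2 := hx.2
      rw [window_diff] at h2
      exact absurd hxΔ h2.2
  · intro hx
    refine ⟨Or.inl (Or.inl hx), ?_⟩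
    rw [← hξ] at hx; exact hx.2

/-- Under the same support conditions the carriers of `ξ ∪ η|_{Λᶜ}` and `ζ` are disjoint.
[folklore] -/
theorem disjoint_union_restrict_compl {Λ Δ : Set Pos} (η : PointConfig Phase)
    {ξ ζ : PointConfig Phase} (hξ : ξ.restrict (window Δ) = ξ)
    (hζ : ζ.restrict (window (Λ \ Δ)) = ζ) :
    Disjoint ((ξ ∪ η.restrict (window Λ)ᶜ : PointConfig Phase) : Set Phase) (ζ : Set Phase) := by
  rw [Set.disjoint_left]
  rintro x (hx | ⟨-, hxΛ⟩) hxζ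
  · rw [← hξ] at hx
    rw [← hζ] at hxζ
    have h2 := hxζ.2
    rw [window_diff] at h2
    exact h2.2 hx.2
  · rw [← hζ] at hxζ
    exact hxΛ (window_mono sdiff_subset hxζ.2)

/-- Restricting the glued superposition to the inner window returns `ξ`. [folklore] -/
theorem restrict_glue_union_eq {Λ Δ : Set Pos} (hΔΛ : Δ ⊆ Λ) (η : PointConfig Phase)
    {ξ ζ : PointConfig Phase} (hξ : ξ.restrict (window Δ) = ξ)
    (hζ : ζ.restrict (window (Λ \ Δ)) = ζ) :
    (glue Λ η (ξ ∪ ζ)).restrict (window Δ) = ξ := by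
  rw [glue_union_eq hΔΛ η hξ hζ, restrict_union_union_eq hΔΛ η hξ hζ]

/-- The region forbidden by a superposition is the union of the forbidden regions. [folklore] -/
theorem biUnion_window_ball_union (σ : ℝ) (c d : PointConfig Phase) :
    (⋃ x ∈ ((c ∪ d : PointConfig Phase) : Set Phase), window (Metric.ball x.1 σ)) =
      (⋃ x ∈ (c : Set Phase), window (Metric.ball x.1 σ)) ∪
        ⋃ x ∈ (d : Set Phase), window (Metric.ball x.1 σ) := by
  rw [show ((c ∪ d : PointConfig Phase) : Set Phase) = (c : Set Phase) ∪ (d : Set Phase) from rfl,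
    biUnion_union]

/-- **Hard core of the glued superposition**: with `ξ` in the window of `Δ ⊆ Λ` and `ζ` in the
window of `Λ ∖ Δ`, `glue Λ η (ξ ∪ ζ)` is hard core iff `ξ ∪ η|_{Λᶜ}` and `ζ` are hard core and `ζ`
avoids the region forbidden by `η|_{Λᶜ}` and by `ξ`. [folklore] -/
theorem isHardCore_glue_union_iff {Λ Δ : Set Pos} (hΔΛ : Δ ⊆ Λ) (η : PointConfig Phase)
    {ξ ζ : PointConfig Phase} (hξ : ξ.restrict (window Δ) = ξ)
    (hζ : ζ.restrict (window (Λ \ Δ)) = ζ) :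
    IsHardCore σ (glue Λ η (ξ ∪ ζ)) ↔
      IsHardCore σ (ξ ∪ η.restrict (window Λ)ᶜ) ∧ IsHardCore σ ζ ∧
        ζ.count ((⋃ x ∈ ((η.restrict (window Λ)ᶜ : PointConfig Phase) : Set Phase),
            window (Metric.ball x.1 σ)) ∪
          ⋃ x ∈ (ξ : Set Phase), window (Metric.ball x.1 σ)) = 0 := by
  rw [glue_union_eq hΔΛ η hξ hζ,
    isHardCore_union_iff_count_eq_zero (disjoint_union_restrict_compl η hξ hζ),
    biUnion_window_ball_union, union_comm]

/-- **The glued reference law on an inner local event, integrated out over `Λ ∖ Δ`**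
(Fubini over the superposition `P_Λ = (P_Δ ⊗ P_{Λ∖Δ}) ∘ ∪⁻¹`): for measurable `A'`,
`P_Λ{ξ' | glue Λ η ξ' is hard core and (glue Λ η ξ')|_Δ ∈ A'} =
 ∫_{A'} 1[ξ ∪ η|_{Λᶜ} hard core] · Z_{Λ∖Δ}(F(η|_{Λᶜ}) ∪ F(ξ)) P_Δ(dξ)`.
[cite: MichelenPerkins2021, §3.2, Lemma 14] -/
theorem measure_glue_preimage_eq_lintegral (h0 : ∀ x, ν {x} = 0) {Λ Δ : Set Pos}
    (hΛ : MeasurableSet Λ) (hΔ : MeasurableSet Δ) (hΔΛ : Δ ⊆ Λ) (η : PointConfig Phase)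
    {A' : Set (PointConfig Phase)} (hA' : MeasurableSet A') :
    poissonLaw (ν.restrict (window Λ))
        (glue Λ η ⁻¹' (PointConfig.restrict (window Δ) ⁻¹' A' ∩ hardCoreSet σ)) =
      ∫⁻ ξ in A', (hardCoreSet σ).indicator (1 : PointConfig Phase → ℝ≥0∞)
          (ξ ∪ η.restrict (window Λ)ᶜ) *
        poissonLaw (ν.restrict (window (Λ \ Δ))) (hardCoreSet σ ∩ {ζ : PointConfig Phase |
          ζ.count ((⋃ x ∈ ((η.restrict (window Λ)ᶜ : PointConfig Phase) : Set Phase),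
              window (Metric.ball x.1 σ)) ∪
            ⋃ x ∈ (ξ : Set Phase), window (Metric.ball x.1 σ)) = 0})
        ∂(poissonLaw (ν.restrict (window Δ))) := by
  classical
  set PΔ := poissonLaw (ν.restrict (window Δ)) with hPΔ
  set PV := poissonLaw (ν.restrict (window (Λ \ Δ))) with hPV
  set ηo := η.restrict (window Λ)ᶜ with hηo
  haveI := (isPoissonPointProcess_poissonLaw_restrict' ν h0 (window Δ)).isProbabilityMeasure
  haveI := (isPoissonPointProcess_poissonLaw_restrict' ν h0 (window (Λ \ Δ))).isProbabilityMeasure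
  have hwΔ : MeasurableSet (window Δ) := HardSphere.measurableSet_window hΔ
  have hwV : MeasurableSet (window (Λ \ Δ)) := HardSphere.measurableSet_window (hΛ.diff hΔ)
  have hC : MeasurableSet (glue Λ η ⁻¹' (PointConfig.restrict (window Δ) ⁻¹' A' ∩ hardCoreSet σ)) :=
    (HardSphere.measurable_glue hΛ η) ((hA'.preimage (PointConfig.measurable_restrict hwΔ)).inter
      (HardSphere.measurableSet_hardCoreSet σ))
  have hu : Measurable fun p : PointConfig Phase × PointConfig Phase => p.1 ∪ p.2 :=
    PointConfig.measurable_union'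
  rw [poissonLaw_window_eq_map_prod ν h0 hΛ hΔ hΔΛ, Measure.map_apply hu hC,
    Measure.prod_apply (hu hC), ← lintegral_indicator hA']
  refine lintegral_congr_ae ?_
  filter_upwards [ae_restrict_eq_self ν h0 hwΔ] with ξ hξ
  set E : Set (PointConfig Phase) := hardCoreSet σ ∩ {ζ : PointConfig Phase |
    ζ.count ((⋃ x ∈ (ηo : Set Phase), window (Metric.ball x.1 σ)) ∪
      ⋃ x ∈ (ξ : Set Phase), window (Metric.ball x.1 σ)) = 0} with hE
  -- the section of the event at `ξ`, up to a `P_{Λ∖Δ}`-null set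
  have hset : (Prod.mk ξ ⁻¹' ((fun p : PointConfig Phase × PointConfig Phase => p.1 ∪ p.2) ⁻¹'
      (glue Λ η ⁻¹' (PointConfig.restrict (window Δ) ⁻¹' A' ∩ hardCoreSet σ)))) =ᵐ[PV]
      (if ξ ∈ A' ∧ IsHardCore σ (ξ ∪ ηo) then E else ∅ : Set (PointConfig Phase)) := by
    filter_upwards [ae_restrict_eq_self ν h0 hwV] with ζ hζ
    refine propext ?_
    change (glue Λ η (ξ ∪ ζ)).restrict (window Δ) ∈ A' ∧ glue Λ η (ξ ∪ ζ) ∈ hardCoreSet σ ↔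
      ζ ∈ (if ξ ∈ A' ∧ IsHardCore σ (ξ ∪ ηo) then E else ∅ : Set (PointConfig Phase))
    rw [HardSphere.mem_hardCoreSet, restrict_glue_union_eq hΔΛ η hξ hζ,
      isHardCore_glue_union_iff hΔΛ η hξ hζ]
    by_cases h : ξ ∈ A' ∧ IsHardCore σ (ξ ∪ ηo)
    · rw [if_pos h]
      simp only [hE, mem_inter_iff, HardSphere.mem_hardCoreSet, mem_setOf_eq, h, true_and]
      exact ⟨fun h' => h'.2, fun h' => ⟨h.2, h'⟩⟩
    · rw [if_neg h]
      simp only [mem_empty_iff_false, iff_false, not_and]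
      intro h1 h2
      exact absurd ⟨h1, h2⟩ h
  rw [measure_congr hset]
  by_cases h : ξ ∈ A' ∧ IsHardCore σ (ξ ∪ ηo)
  · rw [if_pos h, indicator_of_mem h.1, indicator_of_mem (show ξ ∪ ηo ∈ hardCoreSet σ from h.2),
      Pi.one_apply, one_mul]
  · rw [if_neg h, measure_empty]
    by_cases h1 : ξ ∈ A'
    · have h2 : ¬ IsHardCore σ (ξ ∪ ηo) := fun h2 => h ⟨h1, h2⟩
      rw [indicator_of_mem h1, indicator_of_notMem (show ξ ∪ ηo ∉ hardCoreSet σ from h2), zero_mul]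
    · rw [indicator_of_notMem h1]

/-- The case `A' = univ` of `measure_glue_preimage_eq_lintegral`: the normalisation
`P_Λ{glue Λ η ξ' hard core} = ∫ 1[ξ ∪ η|_{Λᶜ} hard core] Z_{Λ∖Δ}(F(η|_{Λᶜ}) ∪ F(ξ)) P_Δ(dξ)`.
[cite: MichelenPerkins2021, §3.2, Lemma 14] -/
theorem measure_glue_preimage_hardCoreSet_eq_lintegral (h0 : ∀ x, ν {x} = 0) {Λ Δ : Set Pos}
    (hΛ : MeasurableSet Λ) (hΔ : MeasurableSet Δ) (hΔΛ : Δ ⊆ Λ) (η : PointConfig Phase) :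
    poissonLaw (ν.restrict (window Λ)) (glue Λ η ⁻¹' hardCoreSet σ) =
      ∫⁻ ξ, (hardCoreSet σ).indicator (1 : PointConfig Phase → ℝ≥0∞)
          (ξ ∪ η.restrict (window Λ)ᶜ) *
        poissonLaw (ν.restrict (window (Λ \ Δ))) (hardCoreSet σ ∩ {ζ : PointConfig Phase |
          ζ.count ((⋃ x ∈ ((η.restrict (window Λ)ᶜ : PointConfig Phase) : Set Phase),
              window (Metric.ball x.1 σ)) ∪
            ⋃ x ∈ (ξ : Set Phase), window (Metric.ball x.1 σ)) = 0})
        ∂(poissonLaw (ν.restrict (window Δ))) := by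
  have h := measure_glue_preimage_eq_lintegral ν h0 hΛ hΔ hΔΛ η (σ := σ) MeasurableSet.univ
  rwa [preimage_univ, univ_inter, Measure.restrict_univ] at h

/-- **The specification on an inner local event as a ratio of two integrals over the inner
reference law**: `γ_Λ(η)(ξ|_Δ ∈ A') = (∫ φ dP_Δ)⁻¹ ∫_{A'} φ dP_Δ` with
`φ(ξ) = 1[ξ ∪ η|_{Λᶜ} hard core] · Z_{Λ∖Δ}(F(η|_{Λᶜ}) ∪ F(ξ))`.
[cite: MichelenPerkins2021, §3.2, Lemma 14] -/
theorem hsLocalSpec_apply_preimage_restrict (h0 : ∀ x, ν {x} = 0) {Λ Δ : Set Pos}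
    (hΛ : MeasurableSet Λ) (hΔ : MeasurableSet Δ) (hΔΛ : Δ ⊆ Λ) (η : PointConfig Phase)
    {A' : Set (PointConfig Phase)} (hA' : MeasurableSet A') :
    hsLocalSpec σ ν Λ η (PointConfig.restrict (window Δ) ⁻¹' A') =
      (∫⁻ ξ, (hardCoreSet σ).indicator (1 : PointConfig Phase → ℝ≥0∞)
          (ξ ∪ η.restrict (window Λ)ᶜ) *
        poissonLaw (ν.restrict (window (Λ \ Δ))) (hardCoreSet σ ∩ {ζ : PointConfig Phase |
          ζ.count ((⋃ x ∈ ((η.restrict (window Λ)ᶜ : PointConfig Phase) : Set Phase),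
              window (Metric.ball x.1 σ)) ∪
            ⋃ x ∈ (ξ : Set Phase), window (Metric.ball x.1 σ)) = 0})
        ∂(poissonLaw (ν.restrict (window Δ))))⁻¹ *
      ∫⁻ ξ in A', (hardCoreSet σ).indicator (1 : PointConfig Phase → ℝ≥0∞)
          (ξ ∪ η.restrict (window Λ)ᶜ) *
        poissonLaw (ν.restrict (window (Λ \ Δ))) (hardCoreSet σ ∩ {ζ : PointConfig Phase |
          ζ.count ((⋃ x ∈ ((η.restrict (window Λ)ᶜ : PointConfig Phase) : Set Phase),
              window (Metric.ball x.1 σ)) ∪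
            ⋃ x ∈ (ξ : Set Phase), window (Metric.ball x.1 σ)) = 0})
        ∂(poissonLaw (ν.restrict (window Δ))) := by
  have hwΔ : MeasurableSet (window Δ) := HardSphere.measurableSet_window hΔ
  have hB : MeasurableSet (PointConfig.restrict (window Δ) ⁻¹' A' : Set (PointConfig Phase)) :=
    hA'.preimage (PointConfig.measurable_restrict hwΔ)
  have hH := HardSphere.measurableSet_hardCoreSet σ
  have hg := HardSphere.measurable_glue hΛ η
  rw [hsLocalSpec_def, Measure.smul_apply, smul_eq_mul, Measure.restrict_apply hB,
    Measure.restrict_apply MeasurableSet.univ, univ_inter, Measure.map_apply hg (hB.inter hH),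
    Measure.map_apply hg hH, measure_glue_preimage_eq_lintegral ν h0 hΛ hΔ hΔΛ η hA',
    measure_glue_preimage_hardCoreSet_eq_lintegral ν h0 hΛ hΔ hΔΛ η]

end InnerWindow

/-! ### Decay of the boundary influence on local events -/

section Boundary

variable {σ : ℝ}

/-- The parametrised void probability `ξ ↦ P{hard core, no point in F₀ ∪ F(ξ)}`, with
`F(ξ) = ⋃_{x ∈ ξ} B°_σ(x)` the region forbidden by the configuration `ξ`, is measurable in `ξ`
(the cross-separation event `{(ξ, ζ) | all pairs σ-separated}` is a zero set of a Campbell sum).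
[folklore] -/
theorem measurable_measure_hardCore_void_biUnion (σ : ℝ) {F₀ : Set Phase} (hF₀ : MeasurableSet F₀)
    (P : Measure (PointConfig Phase)) [SFinite P] :
    Measurable fun ξ : PointConfig Phase => P (hardCoreSet σ ∩ {ζ : PointConfig Phase |
      ζ.count (F₀ ∪ ⋃ x ∈ (ξ : Set Phase), window (Metric.ball x.1 σ)) = 0}) := by
  -- the Campbell sum `∑_{y ∈ ζ} N_ξ(B°_σ(y))` is jointly measurable in `(ξ, ζ)`
  set t : Set (((PointConfig Phase × PointConfig Phase) × Phase) × Phase) :=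
    {r | dist r.2.1 r.1.2.1 < σ} with ht_def
  have ht : MeasurableSet t :=
    measurableSet_lt ((measurable_fst.comp measurable_snd).dist
      (measurable_fst.comp (measurable_snd.comp measurable_fst))) measurable_const
  have hf : Measurable fun q : (PointConfig Phase × PointConfig Phase) × Phase =>
      q.1.1.toMeasure (Prod.mk q ⁻¹' t) :=
    PointConfig.measurable_toMeasure_preimage ht (measurable_fst.comp measurable_fst)
  have hI : Measurable fun p : PointConfig Phase × PointConfig Phase =>
      ∫⁻ y, (fun q : (PointConfig Phase × PointConfig Phase) × Phase =>
        q.1.1.toMeasure (Prod.mk q ⁻¹' t)) (p, y) ∂(p.2).toMeasure :=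
    PointConfig.measurable_lintegral_toMeasure hf measurable_snd
  have hball : ∀ (p : PointConfig Phase × PointConfig Phase) (y : Phase),
      Prod.mk (p, y) ⁻¹' t = window (Metric.ball y.1 σ) := fun p y => by
    ext w
    simp only [ht_def, mem_preimage, mem_setOf_eq, mem_window_ball]
  have hsep : {p : PointConfig Phase × PointConfig Phase |
      ∀ x ∈ p.1, ∀ y ∈ p.2, σ ≤ dist x.1 y.1} =
      (fun p : PointConfig Phase × PointConfig Phase =>
        ∫⁻ y, (fun q : (PointConfig Phase × PointConfig Phase) × Phase =>
          q.1.1.toMeasure (Prod.mk q ⁻¹' t)) (p, y) ∂(p.2).toMeasure) ⁻¹' {0} := by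
    ext p
    simp only [mem_setOf_eq, mem_preimage, mem_singleton_iff]
    rw [PointConfig.lintegral_toMeasure, ENNReal.tsum_eq_zero]
    simp only [hball, PointConfig.toMeasure_apply _ (measurableSet_window_ball σ _),
      ENat.toENNReal_eq_zero, count_eq_zero_iff', mem_window_ball, not_lt, Subtype.forall]
    exact ⟨fun h x hx y hy => h y hy x hx, fun h y hy x hx => h x hx y hy⟩
  set A : Set (PointConfig Phase × PointConfig Phase) := {p | IsHardCore σ p.2 ∧ p.2.count F₀ = 0 ∧
    ∀ x ∈ p.1, ∀ y ∈ p.2, σ ≤ dist x.1 y.1} with hA_def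
  have hA : MeasurableSet A := by
    refine ((HardSphere.measurableSet_hardCoreSet σ).preimage measurable_snd).inter
      (((measurableSet_count_eq_zero hF₀).preimage measurable_snd).inter ?_)
    change MeasurableSet {p : PointConfig Phase × PointConfig Phase |
      ∀ x ∈ p.1, ∀ y ∈ p.2, σ ≤ dist x.1 y.1}
    rw [hsep]
    exact hI (measurableSet_singleton 0)
  have h := measurable_measure_prodMk_left (ν := P) hA
  have heq : (fun ξ : PointConfig Phase => P (hardCoreSet σ ∩ {ζ : PointConfig Phase |
      ζ.count (F₀ ∪ ⋃ x ∈ (ξ : Set Phase), window (Metric.ball x.1 σ)) = 0})) =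
      fun ξ => P (Prod.mk ξ ⁻¹' A) := by
    funext ξ
    congr 1
    ext ζ
    simp only [hA_def, mem_inter_iff, mem_setOf_eq, mem_preimage, HardSphere.mem_hardCoreSet,
      count_union_eq_zero_iff, count_biUnion_window_ball_eq_zero_iff]
    exact Iff.rfl
  rw [heq]
  exact h

/-- For a finite configuration the total count, read in `ℝ`, is the number of points. [folklore] -/
theorem toReal_count_univ_eq_ncard {ξ : PointConfig Phase} (hξ : ((ξ : PointConfig Phase) : Set Phase).Finite) :
    ((ξ.count univ : ℕ∞) : ℝ≥0∞).toReal = ((ξ : Set Phase).ncard : ℝ) := by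
  rw [PointConfig.count, inter_univ, ← PointConfig.coe_eq_carrier, ← hξ.cast_ncard_eq]
  simp

variable (ν : Measure Phase) [IsLocallyFiniteMeasure ν]

/-- **Decay of the boundary influence on local events** (the uniqueness mechanism of
Michelen–Perkins 2021, Thm 25 and §5, in DLR form for the hard-sphere gas).  Let `ν` be a locally
finite atomless one-particle intensity charging no hyperplane `{y₁ = t}` and giving mass `≤ κ` to
every ball window `B°_σ(·)`.  For the volume `Λ = B(0, R)`, the inner window `Δ = B(0, k)` with
`k + (d + 2)σ ≤ R`, and two boundary conditions `η, η'` both hard core outside `Λ`, the finite-volume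
Gibbs distributions `γ_Λ(· | η)`, `γ_Λ(· | η')` (`hsLocalSpec`) give to every event depending only
on the configuration in `Δ` probabilities differing by at most
`2 ν(Δ × ℝ³) e^{ν(Δ × ℝ³)} (2κ)^d`: both are ratios `E[1_{A'} 1_HC q_η] / E[1_HC q_η]` over the
reference law of `Δ`, with `q_η(ξ) = Z_{Λ∖Δ}(F(η) ∪ F(ξ))/Z_{Λ∖Δ}(F(η))`, the regions forbidden by
`η` and `η'` are invisible inside `B(0, R - σ)`, and `|q_η - q_{η'}| ≤ #ξ · (2κ)^d` by the product
bound. [cite: MichelenPerkins2021, Thm 25 and §5.1] -/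
theorem abs_hsLocalSpec_toReal_sub_le (hσ : 0 < σ) (h0 : ∀ x, ν {x} = 0)
    (hm : ∀ t : ℝ, ν {y : Phase | y.1 0 = t} = 0) {κ : ℝ} (hκ0 : 0 ≤ κ)
    (hκ : ∀ a : Pos, ν (window (Metric.ball a σ)) ≤ ENNReal.ofReal κ)
    {k R : ℝ} {d : ℕ} (hR : k + (d + 2) * σ ≤ R)
    (hfin : ν (window (Metric.ball (0 : Pos) R)) ≠ ∞)
    {η η' : PointConfig Phase}
    (hη : IsHardCore σ (η.restrict (window (Metric.ball (0 : Pos) R))ᶜ))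
    (hη' : IsHardCore σ (η'.restrict (window (Metric.ball (0 : Pos) R))ᶜ))
    {A' : Set (PointConfig Phase)} (hA' : MeasurableSet A') :
    |(hsLocalSpec σ ν (Metric.ball 0 R) η
          (PointConfig.restrict (window (Metric.ball 0 k)) ⁻¹' A')).toReal -
      (hsLocalSpec σ ν (Metric.ball 0 R) η'
          (PointConfig.restrict (window (Metric.ball 0 k)) ⁻¹' A')).toReal| ≤
      2 * ν.real (window (Metric.ball (0 : Pos) k)) *
        Real.exp (ν.real (window (Metric.ball (0 : Pos) k))) * (2 * κ) ^ d := by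
  classical
  -- the regions
  set Λ : Set Pos := Metric.ball 0 R with hΛdef
  set Δ : Set Pos := Metric.ball 0 k with hΔdef
  set G : Set Pos := Metric.ball 0 (R - σ) with hGdef
  have hd0 : (0 : ℝ) ≤ d := Nat.cast_nonneg d
  have hkR : k + σ ≤ R := by nlinarith
  have hΔΛ : Δ ⊆ Λ := Metric.ball_subset_ball (by nlinarith)
  have hΛm : MeasurableSet Λ := Metric.isOpen_ball.measurableSet
  have hΔm : MeasurableSet Δ := Metric.isOpen_ball.measurableSet
  have hwΔ : MeasurableSet (window Δ) := HardSphere.measurableSet_window hΔm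
  have hwV : MeasurableSet (window (Λ \ Δ)) := HardSphere.measurableSet_window (hΛm.diff hΔm)
  -- the reference laws
  set PΔ := poissonLaw (ν.restrict (window Δ)) with hPΔdef
  set PV := poissonLaw (ν.restrict (window (Λ \ Δ))) with hPVdef
  have hPΔ : IsPoissonPointProcess (ν.restrict (window Δ)) PΔ :=
    isPoissonPointProcess_poissonLaw_restrict' ν h0 _
  have hPV : IsPoissonPointProcess (ν.restrict (window (Λ \ Δ))) PV :=
    isPoissonPointProcess_poissonLaw_restrict' ν h0 _
  haveI := hPΔ.isProbabilityMeasure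
  haveI := hPV.isProbabilityMeasure
  have hνΔ : ν (window Δ) ≠ ∞ := ne_top_of_le_ne_top hfin (measure_mono (window_mono hΔΛ))
  have hνV : ν (window (Λ \ Δ)) ≠ ∞ :=
    ne_top_of_le_ne_top hfin (measure_mono (window_mono sdiff_subset))
  haveI : IsFiniteMeasure (ν.restrict (window Δ)) :=
    ⟨by rw [Measure.restrict_apply_univ]; exact hνΔ.lt_top⟩
  haveI : IsFiniteMeasure (ν.restrict (window (Λ \ Δ))) :=
    ⟨by rw [Measure.restrict_apply_univ]; exact hνV.lt_top⟩
  have hmV : ∀ t : ℝ, ν.restrict (window (Λ \ Δ)) {y : Phase | y.1 0 = t} = 0 := fun t =>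
    nonpos_iff_eq_zero.mp ((Measure.restrict_apply_le _ _).trans_eq (hm t))
  have hκV : ∀ a : Pos, (ν.restrict (window (Λ \ Δ))).real (window (Metric.ball a σ)) ≤ κ :=
    fun a => ENNReal.toReal_le_of_le_ofReal hκ0 ((Measure.restrict_apply_le _ _).trans (hκ a))
  -- the boundary conditions outside `Λ` and the regions they forbid
  set ηo := η.restrict (window Λ)ᶜ with hηodef
  set ηo' := η'.restrict (window Λ)ᶜ with hηo'def
  set Fη : Set Phase := ⋃ x ∈ (ηo : Set Phase), window (Metric.ball x.1 σ) with hFηdef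
  set Fη' : Set Phase := ⋃ x ∈ (ηo' : Set Phase), window (Metric.ball x.1 σ) with hFη'def
  have hFηm : MeasurableSet Fη := measurableSet_biUnion_window_ball_carrier σ ηo
  have hFη'm : MeasurableSet Fη' := measurableSet_biUnion_window_ball_carrier σ ηo'
  -- geometry (g2): the forbidden regions of the boundary are invisible inside `G`
  have hout : ∀ {ω : PointConfig Phase}, ∀ x ∈ ω.restrict (window Λ)ᶜ, R ≤ ‖x.1‖ := by
    intro ω x hx
    have h2 : x ∉ window Λ := hx.2
    rw [HardSphere.mem_window, hΛdef, mem_ball_zero_iff, not_lt] at h2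
    exact h2
  have hinvis : ∀ {ω : PointConfig Phase},
      (⋃ x ∈ ((ω.restrict (window Λ)ᶜ : PointConfig Phase) : Set Phase),
        window (Metric.ball x.1 σ)) ∩ window G = ∅ := by
    intro ω
    refine eq_empty_of_forall_notMem fun y hy => ?_
    obtain ⟨hy, hyG⟩ := hy
    rw [mem_biUnion_window_ball_iff] at hy
    obtain ⟨x, hx, hxy⟩ := hy
    have hRx := hout x hx
    rw [HardSphere.mem_window, hGdef, mem_ball_zero_iff] at hyG
    have : ‖x.1‖ < R :=
      calc ‖x.1‖ = dist x.1 0 := (dist_zero_right _).symm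
        _ ≤ dist x.1 y.1 + dist y.1 0 := dist_triangle _ _ _
        _ = dist y.1 x.1 + ‖y.1‖ := by rw [dist_comm, dist_zero_right]
        _ < σ + (R - σ) := add_lt_add hxy hyG
        _ = R := by ring
    exact absurd this (not_lt.2 hRx)
  have hagree : Fη ∩ window G = Fη' ∩ window G := by
    rw [hFηdef, hFη'def, hinvis, hinvis]
  -- geometry (g1): inner configurations do not interact with the boundary
  have hsep : ∀ {ω : PointConfig Phase} {ξ : PointConfig Phase}, ξ.restrict (window Δ) = ξ →
      ∀ x ∈ ξ, ∀ y ∈ ω.restrict (window Λ)ᶜ, σ ≤ dist x.1 y.1 := by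
    intro ω ξ hξ x hx y hy
    have hxk : ‖x.1‖ < k := by
      rw [← hξ] at hx
      have h2 : x ∈ window Δ := hx.2
      rwa [HardSphere.mem_window, hΔdef, mem_ball_zero_iff] at h2
    have hRy := hout y hy
    calc σ ≤ R - k := by linarith
      _ ≤ ‖y.1‖ - ‖x.1‖ := by linarith
      _ ≤ ‖y.1 - x.1‖ := norm_sub_norm_le _ _
      _ = dist x.1 y.1 := by rw [dist_comm, dist_eq_norm]
  have hHC : ∀ {ω : PointConfig Phase}, IsHardCore σ (ω.restrict (window Λ)ᶜ) →
      ∀ {ξ : PointConfig Phase}, ξ.restrict (window Δ) = ξ →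
      (IsHardCore σ (ξ ∪ ω.restrict (window Λ)ᶜ) ↔ IsHardCore σ ξ) := by
    intro ω hω ξ hξ
    rw [isHardCore_union_iff]
    exact ⟨fun h => h.1, fun h => ⟨h, hω, fun x hx y hy _ => hsep hξ x hx y hy⟩⟩
  -- geometry (g3): inner points are at depth `d` inside `G`
  have hdepth : ∀ {ξ : PointConfig Phase}, ξ.restrict (window Δ) = ξ →
      ∀ x ∈ (ξ : Set Phase), Metric.ball x.1 ((d + 1) * σ) ⊆ G := by
    intro ξ hξ x hx q hq
    have hxk : ‖x.1‖ < k := by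
      have hx' : x ∈ ξ := hx
      rw [← hξ] at hx'
      have h2 : x ∈ window Δ := hx'.2
      rwa [HardSphere.mem_window, hΔdef, mem_ball_zero_iff] at h2
    rw [Metric.mem_ball] at hq
    rw [hGdef, mem_ball_zero_iff]
    calc ‖q‖ = dist q 0 := (dist_zero_right _).symm
      _ ≤ dist q x.1 + dist x.1 0 := dist_triangle _ _ _
      _ < (d + 1) * σ + k := by rw [dist_zero_right]; exact add_lt_add hq hxk
      _ ≤ R - σ := by linarith
  -- the product bound for inner configurations
  set ZV : Set Phase → ℝ := fun F => PV.real (hardCoreSet σ ∩ {ζ : PointConfig Phase | ζ.count F = 0})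
    with hZVdef
  have hprod : ∀ {ξ : PointConfig Phase}, ξ.restrict (window Δ) = ξ → ((ξ : Set Phase)).Finite →
      |ZV (Fη ∪ ⋃ x ∈ (ξ : Set Phase), window (Metric.ball x.1 σ)) / ZV Fη -
        ZV (Fη' ∪ ⋃ x ∈ (ξ : Set Phase), window (Metric.ball x.1 σ)) / ZV Fη'| ≤
        (ξ : Set Phase).ncard * (2 * κ) ^ d := fun hξ hfin =>
    abs_ratio_biUnion_sub_le hσ hPV hPV hmV hmV hκV (G := G) rfl d _ hfin (hdepth hξ)
      Fη Fη' hFηm hFη'm hagree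
  -- the integrands
  set q : Set Phase → PointConfig Phase → ℝ := fun F ξ =>
    ZV (F ∪ ⋃ x ∈ (ξ : Set Phase), window (Metric.ball x.1 σ)) / ZV F with hqdef
  set f : Set Phase → PointConfig Phase → ℝ := fun F ξ =>
    (hardCoreSet σ).indicator (fun _ => (1 : ℝ)) ξ * q F ξ with hfdef
  set φ : PointConfig Phase → PointConfig Phase → ℝ≥0∞ := fun ω ξ =>
    (hardCoreSet σ).indicator (1 : PointConfig Phase → ℝ≥0∞) (ξ ∪ ω.restrict (window Λ)ᶜ) *
      PV (hardCoreSet σ ∩ {ζ : PointConfig Phase |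
        ζ.count ((⋃ x ∈ ((ω.restrict (window Λ)ᶜ : PointConfig Phase) : Set Phase),
            window (Metric.ball x.1 σ)) ∪
          ⋃ x ∈ (ξ : Set Phase), window (Metric.ball x.1 σ)) = 0}) with hφdef
  have hφm : ∀ ω : PointConfig Phase, Measurable (φ ω) := fun ω => by
    refine Measurable.mul ?_ (measurable_measure_hardCore_void_biUnion σ
      (measurableSet_biUnion_window_ball_carrier σ _) PV)
    exact (measurable_one.indicator (HardSphere.measurableSet_hardCoreSet σ)).comp
      (PointConfig.measurable_union'.comp (measurable_id.prodMk measurable_const))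
  have hφle : ∀ ω ξ, φ ω ξ ≤ 1 := fun ω ξ => by
    simp only [hφdef]
    refine mul_le_one' ?_ prob_le_one
    by_cases h : ξ ∪ ω.restrict (window Λ)ᶜ ∈ hardCoreSet σ
    · rw [indicator_of_mem h, Pi.one_apply]
    · rw [indicator_of_notMem h]; exact zero_le_one
  have hq01 : ∀ F ξ, 0 ≤ q F ξ ∧ q F ξ ≤ 1 := fun F ξ =>
    ⟨ratio_nonneg PV σ _ _, ratio_le_one hPV σ _ _⟩
  have hf01 : ∀ F ξ, 0 ≤ f F ξ ∧ f F ξ ≤ 1 := fun F ξ => by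
    simp only [hfdef]
    by_cases h : ξ ∈ hardCoreSet σ
    · rw [indicator_of_mem h, one_mul]; exact hq01 F ξ
    · rw [indicator_of_notMem h, zero_mul]; exact ⟨le_rfl, zero_le_one⟩
  have hfm : ∀ {F : Set Phase}, MeasurableSet F → Measurable (f F) := fun hF =>
    ((measurable_const.indicator (HardSphere.measurableSet_hardCoreSet σ))).mul
      ((measurable_measure_hardCore_void_biUnion σ hF PV).ennreal_toReal.div_const _)
  have hfi : ∀ {F : Set Phase}, MeasurableSet F → Integrable (f F) PΔ := fun hF =>
    Integrable.of_bound (hfm hF).aestronglyMeasurable 1 (Eventually.of_forall fun ξ => by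
      rw [Real.norm_eq_abs, abs_of_nonneg (hf01 _ ξ).1]; exact (hf01 _ ξ).2)
  -- identification of the specification integrand with `Z_V(F(η)) · f`
  have hident : ∀ {ω : PointConfig Phase}, IsHardCore σ (ω.restrict (window Λ)ᶜ) →
      ∀ {ξ : PointConfig Phase}, ξ.restrict (window Δ) = ξ →
      (φ ω ξ).toReal = ZV (⋃ x ∈ ((ω.restrict (window Λ)ᶜ : PointConfig Phase) : Set Phase),
        window (Metric.ball x.1 σ)) *
        f (⋃ x ∈ ((ω.restrict (window Λ)ᶜ : PointConfig Phase) : Set Phase),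
          window (Metric.ball x.1 σ)) ξ := by
    intro ω hω ξ hξ
    have hZpos := measureReal_hardCore_void_pos hPV σ
      (⋃ x ∈ ((ω.restrict (window Λ)ᶜ : PointConfig Phase) : Set Phase), window (Metric.ball x.1 σ))
    simp only [hφdef, hfdef, hqdef, ENNReal.toReal_mul]
    by_cases h : IsHardCore σ ξ
    · have h' : ξ ∪ ω.restrict (window Λ)ᶜ ∈ hardCoreSet σ := (hHC hω hξ).2 h
      rw [indicator_of_mem h', indicator_of_mem (show ξ ∈ hardCoreSet σ from h), Pi.one_apply,
        ENNReal.toReal_one, one_mul, one_mul, mul_div_cancel₀ _ hZpos.ne']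
      rfl
    · have h' : ξ ∪ ω.restrict (window Λ)ᶜ ∉ hardCoreSet σ := fun h' => h ((hHC hω hξ).1 h')
      rw [indicator_of_notMem h', indicator_of_notMem (show ξ ∉ hardCoreSet σ from h),
        ENNReal.toReal_zero, zero_mul, zero_mul, mul_zero]
  -- the specification as a ratio of real integrals
  have hratio : ∀ {ω : PointConfig Phase}, IsHardCore σ (ω.restrict (window Λ)ᶜ) →
      (hsLocalSpec σ ν Λ ω (PointConfig.restrict (window Δ) ⁻¹' A')).toReal =
        (∫ ξ in A', f (⋃ x ∈ ((ω.restrict (window Λ)ᶜ : PointConfig Phase) : Set Phase),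
            window (Metric.ball x.1 σ)) ξ ∂PΔ) /
          ∫ ξ, f (⋃ x ∈ ((ω.restrict (window Λ)ᶜ : PointConfig Phase) : Set Phase),
            window (Metric.ball x.1 σ)) ξ ∂PΔ := by
    intro ω hω
    set F : Set Phase := ⋃ x ∈ ((ω.restrict (window Λ)ᶜ : PointConfig Phase) : Set Phase),
      window (Metric.ball x.1 σ) with hFdef
    have hFm : MeasurableSet F := measurableSet_biUnion_window_ball_carrier σ _
    have hZpos := measureReal_hardCore_void_pos hPV σ F
    have hfin' : ∀ s : Set (PointConfig Phase), ∫⁻ ξ in s, φ ω ξ ∂PΔ ≠ ∞ := fun s => by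
      refine ne_top_of_le_ne_top (measure_ne_top (PΔ.restrict s) univ) ?_
      calc ∫⁻ ξ in s, φ ω ξ ∂PΔ ≤ ∫⁻ _ in s, 1 ∂PΔ := lintegral_mono fun ξ => hφle ω ξ
        _ = PΔ.restrict s univ := lintegral_one
    have hconv : ∀ s : Set (PointConfig Phase), MeasurableSet s →
        (∫⁻ ξ in s, φ ω ξ ∂PΔ).toReal = ZV F * ∫ ξ in s, f F ξ ∂PΔ := by
      intro s hs
      rw [← integral_toReal (hφm ω).aemeasurable (Eventually.of_forall fun ξ =>
        lt_of_le_of_lt (hφle ω ξ) ENNReal.one_lt_top), ← integral_const_mul]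
      refine integral_congr_ae (ae_restrict_of_ae ?_)
      filter_upwards [ae_restrict_eq_self ν h0 hwΔ] with ξ hξ
      exact hident hω hξ
    have hconvU : (∫⁻ ξ, φ ω ξ ∂PΔ).toReal = ZV F * ∫ ξ, f F ξ ∂PΔ := by
      have h := hconv univ MeasurableSet.univ
      rwa [Measure.restrict_univ] at h
    rw [hsLocalSpec_apply_preimage_restrict ν h0 hΛm hΔm hΔΛ ω hA']
    change ((∫⁻ ξ, φ ω ξ ∂PΔ)⁻¹ * ∫⁻ ξ in A', φ ω ξ ∂PΔ).toReal = _
    rw [ENNReal.toReal_mul, ENNReal.toReal_inv, hconvU, hconv A' hA', inv_mul_eq_div,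
      mul_div_mul_left _ _ hZpos.ne']
  -- the comparison of the two systems' integrands: `|f_η - f_η'| ≤ #ξ (2κ)^d` a.e.
  have hdiff : ∀ᵐ ξ ∂PΔ, |f Fη ξ - f Fη' ξ| ≤ ((ξ.count univ : ℕ∞) : ℝ≥0∞).toReal * (2 * κ) ^ d := by
    filter_upwards [ae_restrict_eq_self ν h0 hwΔ, hPΔ.ae_finite (measure_ne_top _ _)] with ξ hξ hfin
    rw [toReal_count_univ_eq_ncard hfin]
    simp only [hfdef]
    by_cases h : ξ ∈ hardCoreSet σ
    · rw [indicator_of_mem h, one_mul, one_mul]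
      exact hprod hξ hfin
    · rw [indicator_of_notMem h, zero_mul, zero_mul, sub_zero, abs_zero]
      positivity
  have hcount_int : Integrable (fun ξ : PointConfig Phase => ((ξ.count univ : ℕ∞) : ℝ≥0∞).toReal) PΔ := by
    refine integrable_toReal_of_lintegral_ne_top
      (measurable_from_top.comp (PointConfig.measurable_count MeasurableSet.univ)).aemeasurable ?_
    rw [hPΔ.lintegral_count MeasurableSet.univ (measure_ne_top _ _)]
    exact measure_ne_top _ _
  have hcount_val : ∫ ξ, ((ξ.count univ : ℕ∞) : ℝ≥0∞).toReal ∂PΔ = ν.real (window Δ) := by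
    have hmeas : Measurable fun ξ : PointConfig Phase => ((ξ.count univ : ℕ∞) : ℝ≥0∞) :=
      measurable_from_top.comp (PointConfig.measurable_count MeasurableSet.univ)
    have h1 := integral_toReal (μ := PΔ) hmeas.aemeasurable
      ((hPΔ.count_ae_lt_top MeasurableSet.univ (measure_ne_top _ _)).mono fun ξ hξ =>
        ENat.toENNReal_lt_top.2 hξ)
    rw [h1, hPΔ.lintegral_count MeasurableSet.univ (measure_ne_top _ _),
      Measure.restrict_apply_univ, measureReal_def]
  have hclose : ∀ {s : Set (PointConfig Phase)}, MeasurableSet s →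
      |∫ ξ in s, f Fη ξ ∂PΔ - ∫ ξ in s, f Fη' ξ ∂PΔ| ≤ (2 * κ) ^ d * ν.real (window Δ) := by
    intro s hs
    rw [← integral_sub (hfi hFηm).integrableOn (hfi hFη'm).integrableOn]
    calc |∫ ξ in s, (f Fη ξ - f Fη' ξ) ∂PΔ| ≤ ∫ ξ in s, |f Fη ξ - f Fη' ξ| ∂PΔ :=
          abs_integral_le_integral_abs
      _ ≤ ∫ ξ, |f Fη ξ - f Fη' ξ| ∂PΔ :=
          setIntegral_le_integral ((hfi hFηm).sub (hfi hFη'm)).abs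
            (Eventually.of_forall fun ξ => abs_nonneg _)
      _ ≤ ∫ ξ, ((ξ.count univ : ℕ∞) : ℝ≥0∞).toReal * (2 * κ) ^ d ∂PΔ :=
          integral_mono_ae ((hfi hFηm).sub (hfi hFη'm)).abs (hcount_int.mul_const _) hdiff
      _ = (2 * κ) ^ d * ν.real (window Δ) := by rw [integral_mul_const, hcount_val, mul_comm]
  -- lower bound on the denominators: the empty configuration contributes `e^{-ν(Δ × ℝ³)}`
  have hvoid : PΔ.real {ξ : PointConfig Phase | ξ.count univ = 0} = Real.exp (-ν.real (window Δ)) := by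
    rw [measureReal_def, measure_count_univ_eq_zero hPΔ, Measure.restrict_apply_univ,
      ENNReal.toReal_ofReal (Real.exp_nonneg _), measureReal_def]
  have hden : ∀ {F : Set Phase}, MeasurableSet F →
      Real.exp (-ν.real (window Δ)) ≤ ∫ ξ, f F ξ ∂PΔ := by
    intro F hF
    have hZpos := measureReal_hardCore_void_pos hPV σ F
    rw [← hvoid, ← integral_indicator_one (measurableSet_count_eq_zero MeasurableSet.univ)]
    refine integral_mono_ae ((integrable_const 1).indicator
      (measurableSet_count_eq_zero MeasurableSet.univ)) (hfi hF) (Eventually.of_forall fun ξ => ?_)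
    by_cases hξ : ξ ∈ {ξ : PointConfig Phase | ξ.count univ = 0}
    · rw [indicator_of_mem hξ, Pi.one_apply]
      have hξe : ξ = ∅ := eq_empty_of_count_univ_eq_zero hξ
      subst hξe
      simp only [hfdef, hqdef, indicator_of_mem (show (∅ : PointConfig Phase) ∈ hardCoreSet σ from
        HardSphere.isHardCore_empty σ), one_mul]
      rw [show ((∅ : PointConfig Phase) : Set Phase) = ∅ from rfl, biUnion_empty, union_empty,
        div_self hZpos.ne']
    · rw [indicator_of_notMem hξ]; exact (hf01 F ξ).1
  -- conclusion
  rw [hratio hη, hratio hη']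
  have hnum01 : ∀ {F : Set Phase}, MeasurableSet F →
      0 ≤ ∫ ξ in A', f F ξ ∂PΔ ∧ ∫ ξ in A', f F ξ ∂PΔ ≤ ∫ ξ, f F ξ ∂PΔ := fun hF =>
    ⟨integral_nonneg fun ξ => (hf01 _ ξ).1,
      setIntegral_le_integral (hfi hF) (Eventually.of_forall fun ξ => (hf01 _ ξ).1)⟩
  have key := abs_div_sub_div_le_of_abs_sub_le (Real.exp_pos (-ν.real (window Δ)))
    (hnum01 hFη'm).1 (hnum01 hFη'm).2 (hden hFηm) (hden hFη'm) (hclose hA')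
    (by simpa only [Measure.restrict_univ] using hclose MeasurableSet.univ)
  refine key.trans (le_of_eq ?_)
  rw [Real.exp_neg, div_inv_eq_mul]
  ring

end Boundary

end Literature.MathematicalPhysics.KineticTheory

end
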